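import Mathlib
import HarnessLib

/-!
# A crossing lemma for graphs drawn with `x`-monotone arcs

Topic `Literature/Combinatorics/Extremal`. This file proves, from scratch and without any planar
graph theory (no Euler formula, no Jordan curve theorem), the **crossing lemma**
(Ajtai–Chvátal–Newborn–Szemerédi 1982; Leighton 1983) for the class of drawings that occurs in
Székely's proof of Szemerédi–Trotter-type incidence bounds for *function graphs*: the vertices are
finitely many points of `ℝ²` and every edge is the graph of a continuous function over a compact
interval joining its two endpoints (an `x`-monotone arc), no edge passing through a third vertex,
no two edges with the same pair of endpoints.

* `ArcSystem ι` — the data of such a drawing (vertex set `V`, arcs indexed by `ι` with left/right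
  endpoints `l i`, `r i` and height function `f i`), with the standing hypotheses as fields.
* `ArcSystem.Crosses i j` — two distinct arcs have a common point above a common interior abscissa.
* `ArcSystem.card_le_four_mul_card` — **the planar case**: if no two arcs of `A` cross, then
  `#A ≤ 4 · #T` for any vertex set `T` containing the endpoints. The proof is an elementary
  charging argument special to `x`-monotone arcs: at each vertex `v` the arcs leaving `v` to the
  right are linearly ordered by height; to each pair of *consecutive* such arcs (a "gap") we attach
  the leftmost vertex `w` in the closed region between them, and show that `w` receives at most
  three gaps (one per "type": `w` is the right end of the lower arc, of the upper arc, or strictly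
  between them), because two gaps of the same type at `w` would put an arc strictly inside the
  other gap just to the left of `w`, which the choice of `w` forbids. Only the intermediate value
  theorem and one-sided limits are used.
* `ArcSystem.two_mul_card_le` — removing one arc per crossing: `2·#A ≤ 8·#T + #crossPairs A`
  (ordered crossing pairs).
* `ArcSystem.crossing_inequality` — **the crossing lemma** by the probabilistic (weighted-sum)
  amplification: if crossing arcs never share an endpoint and `e ≥ 8·#V` then
  `e³ ≤ 64 · #V² · #crossPairs` (i.e. `cr ≥ e³ / (128 #V²)` for unordered pairs).

This is the tool needed for the Eisenbrand–Pach–Rothvoß–Sopher bound on convexly independent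
subsets of Minkowski sums (KPTT 2015, Thm 4) via Székely's method; see
`Literature/Computability/AlgebraicComplexity/NewtonPolygonTau*.lean`.

## References

* M. Ajtai, V. Chvátal, M. Newborn, E. Szemerédi, *Crossing-free subgraphs*, Ann. Discrete Math.
  12 (1982) 9–12; F. T. Leighton, *Complexity Issues in VLSI*, MIT Press 1983 (the crossing lemma).
* L. A. Székely, *Crossing numbers and hard Erdős problems in discrete geometry*, Combin. Probab.
  Comput. 6 (1997) 353–358 (the method).
-/

noncomputable section

open Set Filter Topology

namespace Literature.Combinatorics.Extremal

/-- An **`x`-monotone arc system**: a finite vertex set `V ⊆ ℝ²` and arcs indexed by `ι`; arc `i`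
is the graph of the continuous function `f i` over `[ (l i).1, (r i).1 ]`, joining the vertices
`l i` (left) and `r i` (right, with strictly larger abscissa); no arc passes through a vertex other
than its endpoints (`avoid`) and two arcs with the same endpoints are equal (`simple`). [folklore] -/
structure ArcSystem (ι : Type*) where
  /-- the vertices -/
  V : Finset (ℝ × ℝ)
  /-- left endpoint of an arc -/
  l : ι → ℝ × ℝ
  /-- right endpoint of an arc -/
  r : ι → ℝ × ℝ
  /-- the height function whose graph is the arc -/
  f : ι → ℝ → ℝ
  l_mem : ∀ i, l i ∈ V
  r_mem : ∀ i, r i ∈ V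
  fst_lt : ∀ i, (l i).1 < (r i).1
  f_l : ∀ i, f i (l i).1 = (l i).2
  f_r : ∀ i, f i (r i).1 = (r i).2
  cont : ∀ i, ContinuousOn (f i) (Icc (l i).1 (r i).1)
  avoid : ∀ i, ∀ u ∈ V, (l i).1 < u.1 → u.1 < (r i).1 → f i u.1 ≠ u.2
  simple : ∀ i j, l i = l j → r i = r j → i = j

namespace ArcSystem

variable {ι : Type*} (D : ArcSystem ι)

/-- Arcs `i ≠ j` **cross**: their graphs meet above a common interior abscissa. [folklore] -/
def Crosses (i j : ι) : Prop :=
  i ≠ j ∧ ∃ x, (D.l i).1 < x ∧ x < (D.r i).1 ∧ (D.l j).1 < x ∧ x < (D.r j).1 ∧ D.f i x = D.f j x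

variable {D} in
/-- Crossing is symmetric. [folklore] -/
theorem Crosses.symm {i j : ι} (h : D.Crosses i j) : D.Crosses j i := by
  obtain ⟨hne, x, h1, h2, h3, h4, h5⟩ := h
  exact ⟨hne.symm, x, h3, h4, h1, h2, h5.symm⟩

/-! ### Sign constancy and one-sided limits -/

/-- Two non-crossing arcs keep their vertical order over their common open `x`-range
(intermediate value theorem). [folklore] -/
theorem lt_of_lt_of_not_crosses {i j : ι} (hij : i ≠ j) (hnc : ¬ D.Crosses i j) {x₀ x : ℝ}
    (hi₀ : (D.l i).1 < x₀ ∧ x₀ < (D.r i).1) (hj₀ : (D.l j).1 < x₀ ∧ x₀ < (D.r j).1)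
    (hi : (D.l i).1 < x ∧ x < (D.r i).1) (hj : (D.l j).1 < x ∧ x < (D.r j).1)
    (h₀ : D.f i x₀ < D.f j x₀) : D.f i x < D.f j x := by
  by_contra hle
  replace hle := not_lt.1 hle
  have hsub : uIcc x₀ x ⊆ Ioo (D.l i).1 (D.r i).1 ∩ Ioo (D.l j).1 (D.r j).1 :=
    (ordConnected_Ioo.inter ordConnected_Ioo).uIcc_subset ⟨hi₀, hj₀⟩ ⟨hi, hj⟩
  have hcont : ContinuousOn (fun t => D.f i t - D.f j t) (uIcc x₀ x) :=
    ((D.cont i).mono fun t ht => Ioo_subset_Icc_self (hsub ht).1).sub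
      ((D.cont j).mono fun t ht => Ioo_subset_Icc_self (hsub ht).2)
  have h0 : (0 : ℝ) ∈ uIcc (D.f i x₀ - D.f j x₀) (D.f i x - D.f j x) :=
    mem_uIcc.2 (Or.inl ⟨by linarith, by linarith⟩)
  obtain ⟨c, hc, hc0⟩ := intermediate_value_uIcc hcont h0
  have hc' := hsub hc
  exact hnc ⟨hij, c, hc'.1.1, hc'.1.2, hc'.2.1, hc'.2.2, sub_eq_zero.1 hc0⟩

/-- Left limit of an arc's height at a point of its `x`-range. [folklore] -/
theorem tendsto_nhdsLT {i : ι} {x : ℝ} (h1 : (D.l i).1 < x) (h2 : x ≤ (D.r i).1) :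
    Tendsto (D.f i) (𝓝[<] x) (𝓝 (D.f i x)) := by
  have hcw : ContinuousWithinAt (D.f i) (Ioo (D.l i).1 x) x :=
    (D.cont i x ⟨h1.le, h2⟩).mono fun t ht => ⟨ht.1.le, ht.2.le.trans h2⟩
  rwa [ContinuousWithinAt, nhdsWithin_Ioo_eq_nhdsLT h1] at hcw

/-- Right limit of an arc's height at a point of its `x`-range. [folklore] -/
theorem tendsto_nhdsGT {i : ι} {x : ℝ} (h1 : (D.l i).1 ≤ x) (h2 : x < (D.r i).1) :
    Tendsto (D.f i) (𝓝[>] x) (𝓝 (D.f i x)) := by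
  have hcw : ContinuousWithinAt (D.f i) (Ioo x (D.r i).1) x :=
    (D.cont i x ⟨h1, h2.le⟩).mono fun t ht => ⟨h1.trans ht.1.le, ht.2.le⟩
  rwa [ContinuousWithinAt, nhdsWithin_Ioo_eq_nhdsGT h2] at hcw

/-! ### Sub-drawings, fans at a vertex, gaps -/

/-- `A` is a sub-drawing on the vertex set `T ⊆ V`: the endpoints of the arcs of `A` lie in `T`.
[folklore] -/
structure SubDrawing (A : Finset ι) (T : Finset (ℝ × ℝ)) : Prop where
  subset : T ⊆ D.V
  l_mem : ∀ i ∈ A, D.l i ∈ T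
  r_mem : ∀ i ∈ A, D.r i ∈ T

/-- The arcs of `A` whose left endpoint is `v` (the right fan at `v`). [folklore] -/
def out (A : Finset ι) (v : ℝ × ℝ) : Finset ι := A.filter fun i => D.l i = v

/-- Membership in the right fan. [folklore] -/
theorem mem_out {A : Finset ι} {v : ℝ × ℝ} {i : ι} : i ∈ D.out A v ↔ i ∈ A ∧ D.l i = v :=
  Finset.mem_filter

/-- A sample abscissa just to the right of `v`, inside the `x`-range of every arc of the right fan
at `v` (junk `v.1` if the fan is empty). [folklore] -/
def tR (A : Finset ι) (v : ℝ × ℝ) : ℝ :=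
  if h : (D.out A v).Nonempty then
    ((D.out A v).image fun i => (v.1 + (D.r i).1) / 2).min' (h.image _)
  else v.1

/-- The sample abscissa lies strictly inside the `x`-range of every arc of the fan. [folklore] -/
theorem tR_spec {A : Finset ι} {v : ℝ × ℝ} {i : ι} (hi : i ∈ D.out A v) :
    v.1 < D.tR A v ∧ D.tR A v < (D.r i).1 := by
  have hne : (D.out A v).Nonempty := ⟨i, hi⟩
  have hli : D.l i = v := (D.mem_out.1 hi).2
  unfold tR
  rw [dif_pos hne]
  have hmem := ((D.out A v).image fun i => (v.1 + (D.r i).1) / 2).min'_mem (hne.image _)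
  obtain ⟨j, hj, hjeq⟩ := Finset.mem_image.1 hmem
  have hlj : D.l j = v := (D.mem_out.1 hj).2
  have hj' := D.fst_lt j
  have hi' := D.fst_lt i
  rw [hlj] at hj'
  rw [hli] at hi'
  constructor
  · rw [← hjeq]
    linarith
  · have hle : ((D.out A v).image fun i => (v.1 + (D.r i).1) / 2).min' (hne.image _) ≤
        (v.1 + (D.r i).1) / 2 :=
      Finset.min'_le _ _ (Finset.mem_image_of_mem _ hi)
    linarith

/-- The height of arc `i` at the sample abscissa of the fan at `v` ("key"): the right fan at `v`
is linearly ordered by keys. [folklore] -/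
def key (A : Finset ι) (v : ℝ × ℝ) (i : ι) : ℝ := D.f i (D.tR A v)

/-- Distinct non-crossing arcs of a fan have distinct keys. [folklore] -/
theorem eq_of_key_eq {A : Finset ι} {v : ℝ × ℝ} (hnc : ∀ i ∈ A, ∀ j ∈ A, ¬ D.Crosses i j)
    {i j : ι} (hi : i ∈ D.out A v) (hj : j ∈ D.out A v) (hk : D.key A v i = D.key A v j) :
    i = j := by
  by_contra hne
  obtain ⟨hiA, hli⟩ := D.mem_out.1 hi
  obtain ⟨hjA, hlj⟩ := D.mem_out.1 hj
  have h1 := D.tR_spec hi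
  have h2 := D.tR_spec hj
  exact hnc i hiA j hjA
    ⟨hne, D.tR A v, by rw [hli]; exact h1.1, h1.2, by rw [hlj]; exact h2.1, h2.2, hk⟩

/-- A smaller key means lying below on the whole common `x`-range. [folklore] -/
theorem lt_of_key_lt {A : Finset ι} {v : ℝ × ℝ} (hnc : ∀ i ∈ A, ∀ j ∈ A, ¬ D.Crosses i j)
    {i j : ι} (hi : i ∈ D.out A v) (hj : j ∈ D.out A v) (hk : D.key A v i < D.key A v j)
    {x : ℝ} (hx : v.1 < x) (hxi : x < (D.r i).1) (hxj : x < (D.r j).1) : D.f i x < D.f j x := by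
  obtain ⟨hiA, hli⟩ := D.mem_out.1 hi
  obtain ⟨hjA, hlj⟩ := D.mem_out.1 hj
  have hne : i ≠ j := fun h => by subst h; exact lt_irrefl _ hk
  have h1 := D.tR_spec hi
  have h2 := D.tR_spec hj
  exact D.lt_of_lt_of_not_crosses hne (hnc i hiA j hjA) ⟨by rw [hli]; exact h1.1, h1.2⟩
    ⟨by rw [hlj]; exact h2.1, h2.2⟩ ⟨by rw [hli]; exact hx, hxi⟩ ⟨by rw [hlj]; exact hx, hxj⟩ hk

/-- Lying below at one common abscissa means a smaller key. [folklore] -/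
theorem key_lt_of_lt {A : Finset ι} {v : ℝ × ℝ} (hnc : ∀ i ∈ A, ∀ j ∈ A, ¬ D.Crosses i j)
    {i j : ι} (hi : i ∈ D.out A v) (hj : j ∈ D.out A v) {x : ℝ} (hx : v.1 < x)
    (hxi : x < (D.r i).1) (hxj : x < (D.r j).1) (h : D.f i x < D.f j x) :
    D.key A v i < D.key A v j := by
  rcases lt_trichotomy (D.key A v i) (D.key A v j) with hlt | heq | hgt
  · exact hlt
  · have hij := D.eq_of_key_eq hnc hi hj heq
    subst hij
    exact absurd h (lt_irrefl _)
  · exact absurd h (not_lt.2 (D.lt_of_key_lt hnc hj hi hgt hx hxj hxi).le)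

/-- Arc `i` is the **top** arc of its right fan (largest key). [folklore] -/
def IsTop (A : Finset ι) (i : ι) : Prop :=
  ∀ k ∈ D.out A (D.l i), D.key A (D.l i) k ≤ D.key A (D.l i) i

/-- The arc immediately above `i` in its right fan (junk `i` when `i` is a top arc). [folklore] -/
def succ (A : Finset ι) (i : ι) : ι :=
  if h : ((D.out A (D.l i)).filter fun k => D.key A (D.l i) i < D.key A (D.l i) k).Nonempty then
    Classical.choose (Finset.exists_min_image _ (D.key A (D.l i)) h)
  else i

/-- Specification of `succ` for a non-top arc: it is in the same fan, strictly above, and no arc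
of the fan lies strictly between. [folklore] -/
theorem succ_spec {A : Finset ι} {i : ι} (hnt : ¬ D.IsTop A i) :
    D.succ A i ∈ D.out A (D.l i) ∧ D.key A (D.l i) i < D.key A (D.l i) (D.succ A i) ∧
      ∀ k ∈ D.out A (D.l i), D.key A (D.l i) i < D.key A (D.l i) k →
        D.key A (D.l i) (D.succ A i) ≤ D.key A (D.l i) k := by
  have hne : ((D.out A (D.l i)).filter fun k => D.key A (D.l i) i < D.key A (D.l i) k).Nonempty := by
    simp only [IsTop, not_forall, not_le] at hnt
    obtain ⟨k, hk, hlt⟩ := hnt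
    exact ⟨k, Finset.mem_filter.2 ⟨hk, hlt⟩⟩
  unfold succ
  rw [dif_pos hne]
  obtain ⟨hmem, hmin⟩ := Classical.choose_spec (Finset.exists_min_image _ (D.key A (D.l i)) hne)
  exact ⟨(Finset.mem_filter.1 hmem).1, (Finset.mem_filter.1 hmem).2,
    fun k hk hlt => hmin k (Finset.mem_filter.2 ⟨hk, hlt⟩)⟩

/-- The candidate vertices for the gap above a non-top arc `i`: vertices of `T` strictly to the
right of `l i`, not beyond the right ends of `i` and `succ i`, and weakly between the two arcs.
[folklore] -/
def Wset (A : Finset ι) (T : Finset (ℝ × ℝ)) (i : ι) : Finset (ℝ × ℝ) :=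
  T.filter fun u => (D.l i).1 < u.1 ∧ u.1 ≤ (D.r i).1 ∧ u.1 ≤ (D.r (D.succ A i)).1 ∧
    D.f i u.1 ≤ u.2 ∧ u.2 ≤ D.f (D.succ A i) u.1

/-- Membership in `Wset`. [folklore] -/
theorem mem_Wset {A : Finset ι} {T : Finset (ℝ × ℝ)} {i : ι} {u : ℝ × ℝ} :
    u ∈ D.Wset A T i ↔ u ∈ T ∧ (D.l i).1 < u.1 ∧ u.1 ≤ (D.r i).1 ∧ u.1 ≤ (D.r (D.succ A i)).1 ∧
      D.f i u.1 ≤ u.2 ∧ u.2 ≤ D.f (D.succ A i) u.1 :=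
  Finset.mem_filter

/-- The vertex charged by the gap above `i`: a leftmost candidate vertex (junk `r i` if there is
none). [folklore] -/
def wPt (A : Finset ι) (T : Finset (ℝ × ℝ)) (i : ι) : ℝ × ℝ :=
  if h : (D.Wset A T i).Nonempty then
    Classical.choose ((D.Wset A T i).exists_min_image Prod.fst h)
  else D.r i

/-- Specification of `wPt` when candidates exist. [folklore] -/
theorem wPt_spec {A : Finset ι} {T : Finset (ℝ × ℝ)} {i : ι} (h : (D.Wset A T i).Nonempty) :
    D.wPt A T i ∈ D.Wset A T i ∧ ∀ u ∈ D.Wset A T i, (D.wPt A T i).1 ≤ u.1 := by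
  unfold wPt
  rw [dif_pos h]
  exact Classical.choose_spec ((D.Wset A T i).exists_min_image Prod.fst h)

section gap

variable {A : Finset ι} {T : Finset (ℝ × ℝ)}

/-- For a non-top arc there is always a candidate vertex: the right end of `i` or of `succ i`,
whichever comes first. [folklore] -/
theorem Wset_nonempty (hnc : ∀ i ∈ A, ∀ j ∈ A, ¬ D.Crosses i j) (hS : D.SubDrawing A T)
    {i : ι} (hi : i ∈ A) (hnt : ¬ D.IsTop A i) : (D.Wset A T i).Nonempty := by
  obtain ⟨hj, hkey, -⟩ := D.succ_spec hnt
  set j := D.succ A i with hjdef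
  obtain ⟨hjA, hlj⟩ := D.mem_out.1 hj
  have hiout : i ∈ D.out A (D.l i) := D.mem_out.2 ⟨hi, rfl⟩
  have hlt : ∀ x, (D.l i).1 < x → x < (D.r i).1 → x < (D.r j).1 → D.f i x < D.f j x :=
    fun x hx hxi hxj => D.lt_of_key_lt hnc hiout hj hkey hx hxi hxj
  have hlj1 : (D.l j).1 = (D.l i).1 := by rw [hlj]
  have hjlt : (D.l i).1 < (D.r j).1 := by rw [← hlj1]; exact D.fst_lt j
  rcases le_or_gt (D.r i).1 (D.r j).1 with hle | hgt
  · refine ⟨D.r i, D.mem_Wset.2 ⟨hS.r_mem i hi, D.fst_lt i, le_rfl, hle, (D.f_r i).le, ?_⟩⟩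
    have h1 : Tendsto (D.f i) (𝓝[<] (D.r i).1) (𝓝 (D.f i (D.r i).1)) :=
      D.tendsto_nhdsLT (D.fst_lt i) le_rfl
    have h2 : Tendsto (D.f j) (𝓝[<] (D.r i).1) (𝓝 (D.f j (D.r i).1)) :=
      D.tendsto_nhdsLT (by rw [hlj1]; exact D.fst_lt i) hle
    have hev : ∀ᶠ x in 𝓝[<] (D.r i).1, D.f i x ≤ D.f j x := by
      filter_upwards [Ioo_mem_nhdsLT (D.fst_lt i)] with x hx
      exact (hlt x hx.1 hx.2 (hx.2.trans_le hle)).le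
    have := le_of_tendsto_of_tendsto h1 h2 hev
    rwa [D.f_r i] at this
  · refine ⟨D.r j, D.mem_Wset.2 ⟨hS.r_mem j hjA, hjlt, hgt.le, le_rfl, ?_, (D.f_r j).ge⟩⟩
    have h1 : Tendsto (D.f i) (𝓝[<] (D.r j).1) (𝓝 (D.f i (D.r j).1)) :=
      D.tendsto_nhdsLT hjlt hgt.le
    have h2 : Tendsto (D.f j) (𝓝[<] (D.r j).1) (𝓝 (D.f j (D.r j).1)) :=
      D.tendsto_nhdsLT (D.fst_lt j) le_rfl
    have hev : ∀ᶠ x in 𝓝[<] (D.r j).1, D.f i x ≤ D.f j x := by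
      filter_upwards [Ioo_mem_nhdsLT hjlt] with x hx
      exact (hlt x hx.1 (hx.2.trans hgt) hx.2).le
    have := le_of_tendsto_of_tendsto h1 h2 hev
    rwa [D.f_r j] at this

/-- The charged vertex of a non-top arc is a candidate vertex … [folklore] -/
theorem wPt_mem (hnc : ∀ i ∈ A, ∀ j ∈ A, ¬ D.Crosses i j) (hS : D.SubDrawing A T)
    {i : ι} (hi : i ∈ A) (hnt : ¬ D.IsTop A i) : D.wPt A T i ∈ D.Wset A T i :=
  (D.wPt_spec (D.Wset_nonempty hnc hS hi hnt)).1

/-- … and a leftmost one. [folklore] -/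
theorem wPt_min (hnc : ∀ i ∈ A, ∀ j ∈ A, ¬ D.Crosses i j) (hS : D.SubDrawing A T)
    {i : ι} (hi : i ∈ A) (hnt : ¬ D.IsTop A i) {u : ℝ × ℝ} (hu : u ∈ D.Wset A T i) :
    (D.wPt A T i).1 ≤ u.1 :=
  (D.wPt_spec (D.Wset_nonempty hnc hS hi hnt)).2 u hu

/-- **Key step.** Let `i` be a non-top arc with upper neighbour `j = succ i`, common left endpoint
`v` and charged vertex `w`. Then no arc `k` of the drawing that is present just to the left of `w`
lies strictly between `i` and `j` there: such a `k` would either start at a candidate vertex to the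
left of `w`, or belong to the fan at `v` strictly between the consecutive arcs `i`, `j`, or pass
through the vertex `v`. [folklore] -/
theorem no_between (hnc : ∀ i ∈ A, ∀ j ∈ A, ¬ D.Crosses i j) (hS : D.SubDrawing A T)
    {i : ι} (hi : i ∈ A) (hnt : ¬ D.IsTop A i) {k : ι} (hk : k ∈ A)
    (hk1 : (D.l k).1 < (D.wPt A T i).1) (hk2 : (D.wPt A T i).1 ≤ (D.r k).1)
    {x : ℝ} (hxk : (D.l k).1 < x) (hxi : (D.l i).1 < x) (hxw : x < (D.wPt A T i).1)
    (h1 : D.f i x < D.f k x) (h2 : D.f k x < D.f (D.succ A i) x) : False := by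
  obtain ⟨hj, hkey, hmin⟩ := D.succ_spec hnt
  set j := D.succ A i with hjdef
  set w := D.wPt A T i with hwdef
  obtain ⟨hjA, hlj⟩ := D.mem_out.1 hj
  have hlj1 : (D.l j).1 = (D.l i).1 := by rw [hlj]
  obtain ⟨hwT, hvw, hwri, hwrj, -, -⟩ := D.mem_Wset.1 (D.wPt_mem hnc hS hi hnt)
  have hki : k ≠ i := fun h => by rw [h] at h1; exact lt_irrefl _ h1
  have hkj : k ≠ j := fun h => by rw [h] at h2; exact lt_irrefl _ h2
  -- the strict inequalities hold on the whole interval `(max (l k).1 (l i).1, w.1)`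
  have hI : ∀ y, (D.l k).1 < y → (D.l i).1 < y → y < w.1 →
      D.f i y < D.f k y ∧ D.f k y < D.f j y := by
    intro y hyk hyi hyw
    constructor
    · exact D.lt_of_lt_of_not_crosses hki.symm (hnc i hi k hk) ⟨hxi, hxw.trans_le hwri⟩
        ⟨hxk, hxw.trans_le hk2⟩ ⟨hyi, hyw.trans_le hwri⟩ ⟨hyk, hyw.trans_le hk2⟩ h1
    · exact D.lt_of_lt_of_not_crosses hkj (hnc k hk j hjA) ⟨hxk, hxw.trans_le hk2⟩
        ⟨by rw [hlj1]; exact hxi, hxw.trans_le hwrj⟩ ⟨hyk, hyw.trans_le hk2⟩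
        ⟨by rw [hlj1]; exact hyi, hyw.trans_le hwrj⟩ h2
  rcases lt_trichotomy (D.l i).1 (D.l k).1 with hlt | heq | hgt
  · -- `l k` is a candidate vertex strictly to the left of `w`
    have hu : D.l k ∈ T := hS.l_mem k hk
    have hti : Tendsto (D.f i) (𝓝[>] (D.l k).1) (𝓝 (D.f i (D.l k).1)) :=
      D.tendsto_nhdsGT hlt.le (hk1.trans_le hwri)
    have htk : Tendsto (D.f k) (𝓝[>] (D.l k).1) (𝓝 (D.f k (D.l k).1)) :=
      D.tendsto_nhdsGT le_rfl (D.fst_lt k)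
    have htj : Tendsto (D.f j) (𝓝[>] (D.l k).1) (𝓝 (D.f j (D.l k).1)) :=
      D.tendsto_nhdsGT (by rw [hlj1]; exact hlt.le) (hk1.trans_le hwrj)
    have hev : ∀ᶠ y in 𝓝[>] (D.l k).1, D.f i y < D.f k y ∧ D.f k y < D.f j y := by
      filter_upwards [Ioo_mem_nhdsGT hk1] with y hy
      exact hI y hy.1 (hlt.trans hy.1) hy.2
    have hle1 : D.f i (D.l k).1 ≤ D.f k (D.l k).1 :=
      le_of_tendsto_of_tendsto hti htk (hev.mono fun y hy => hy.1.le)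
    have hle2 : D.f k (D.l k).1 ≤ D.f j (D.l k).1 :=
      le_of_tendsto_of_tendsto htk htj (hev.mono fun y hy => hy.2.le)
    rw [D.f_l k] at hle1 hle2
    have hmem : D.l k ∈ D.Wset A T i :=
      D.mem_Wset.2 ⟨hu, hlt, hk1.le.trans hwri, hk1.le.trans hwrj, hle1, hle2⟩
    exact absurd (D.wPt_min hnc hS hi hnt hmem) (not_le.2 hk1)
  · -- `k` belongs to the fan at `v = l i`, strictly between the consecutive arcs `i` and `j`
    have htk : Tendsto (D.f k) (𝓝[>] (D.l i).1) (𝓝 (D.f k (D.l i).1)) :=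
      D.tendsto_nhdsGT heq.ge (by rw [heq]; exact D.fst_lt k)
    have hti : Tendsto (D.f i) (𝓝[>] (D.l i).1) (𝓝 (D.f i (D.l i).1)) :=
      D.tendsto_nhdsGT le_rfl (D.fst_lt i)
    have htj : Tendsto (D.f j) (𝓝[>] (D.l i).1) (𝓝 (D.f j (D.l i).1)) :=
      D.tendsto_nhdsGT hlj1.le (by rw [← hlj1]; exact D.fst_lt j)
    have hev : ∀ᶠ y in 𝓝[>] (D.l i).1, D.f i y < D.f k y ∧ D.f k y < D.f j y := by
      filter_upwards [Ioo_mem_nhdsGT hvw] with y hy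
      exact hI y (by rw [← heq]; exact hy.1) hy.1 hy.2
    have hle1 : D.f i (D.l i).1 ≤ D.f k (D.l i).1 :=
      le_of_tendsto_of_tendsto hti htk (hev.mono fun y hy => hy.1.le)
    have hle2 : D.f k (D.l i).1 ≤ D.f j (D.l i).1 :=
      le_of_tendsto_of_tendsto htk htj (hev.mono fun y hy => hy.2.le)
    rw [D.f_l i] at hle1
    rw [← hlj1, D.f_l j, hlj] at hle2
    have hfk : D.f k (D.l i).1 = (D.l i).2 := le_antisymm hle2 hle1
    have hlk : D.l k = D.l i := by
      refine Prod.ext heq.symm ?_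
      have := D.f_l k
      rw [← heq] at this
      rw [← this, hfk]
    have hkout : k ∈ D.out A (D.l i) := D.mem_out.2 ⟨hk, hlk⟩
    have hiout : i ∈ D.out A (D.l i) := D.mem_out.2 ⟨hi, rfl⟩
    have hk1' := (hI x hxk hxi hxw)
    have key1 : D.key A (D.l i) i < D.key A (D.l i) k :=
      D.key_lt_of_lt hnc hiout hkout hxi (hxw.trans_le hwri) (hxw.trans_le hk2) hk1'.1
    have key2 : D.key A (D.l i) k < D.key A (D.l i) j :=
      D.key_lt_of_lt hnc hkout hj hxi (hxw.trans_le hk2) (hxw.trans_le hwrj) hk1'.2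
    exact absurd (hmin k hkout key1) (not_le.2 key2)
  · -- `k` passes through the vertex `v = l i`
    have htk : Tendsto (D.f k) (𝓝[>] (D.l i).1) (𝓝 (D.f k (D.l i).1)) :=
      D.tendsto_nhdsGT hgt.le (hvw.trans_le hk2)
    have hti : Tendsto (D.f i) (𝓝[>] (D.l i).1) (𝓝 (D.f i (D.l i).1)) :=
      D.tendsto_nhdsGT le_rfl (D.fst_lt i)
    have htj : Tendsto (D.f j) (𝓝[>] (D.l i).1) (𝓝 (D.f j (D.l i).1)) :=
      D.tendsto_nhdsGT hlj1.le (by rw [← hlj1]; exact D.fst_lt j)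
    have hev : ∀ᶠ y in 𝓝[>] (D.l i).1, D.f i y < D.f k y ∧ D.f k y < D.f j y := by
      filter_upwards [Ioo_mem_nhdsGT hvw] with y hy
      exact hI y (hgt.trans hy.1) hy.1 hy.2
    have hle1 : D.f i (D.l i).1 ≤ D.f k (D.l i).1 :=
      le_of_tendsto_of_tendsto hti htk (hev.mono fun y hy => hy.1.le)
    have hle2 : D.f k (D.l i).1 ≤ D.f j (D.l i).1 :=
      le_of_tendsto_of_tendsto htk htj (hev.mono fun y hy => hy.2.le)
    rw [D.f_l i] at hle1
    rw [← hlj1, D.f_l j, hlj] at hle2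
    have hfk : D.f k (D.l i).1 = (D.l i).2 := le_antisymm hle2 hle1
    exact D.avoid k (D.l i) (hS.subset (hS.l_mem i hi)) hgt (hvw.trans_le hk2) hfk

/-- Filter form of `no_between`: the two strict inequalities cannot both hold eventually to the
left of the charged vertex. [folklore] -/
theorem no_between_eventually (hnc : ∀ i ∈ A, ∀ j ∈ A, ¬ D.Crosses i j) (hS : D.SubDrawing A T)
    {i : ι} (hi : i ∈ A) (hnt : ¬ D.IsTop A i) {k : ι} (hk : k ∈ A)
    (hk1 : (D.l k).1 < (D.wPt A T i).1) (hk2 : (D.wPt A T i).1 ≤ (D.r k).1)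
    (h1 : ∀ᶠ x in 𝓝[<] (D.wPt A T i).1, D.f i x < D.f k x)
    (h2 : ∀ᶠ x in 𝓝[<] (D.wPt A T i).1, D.f k x < D.f (D.succ A i) x) : False := by
  obtain ⟨-, hvw, -, -, -, -⟩ := D.mem_Wset.1 (D.wPt_mem hnc hS hi hnt)
  have h3 : ∀ᶠ x in 𝓝[<] (D.wPt A T i).1,
      max (D.l k).1 (D.l i).1 < x ∧ x < (D.wPt A T i).1 :=
    Ioo_mem_nhdsLT (max_lt hk1 hvw)
  obtain ⟨x, ⟨hx1, hx2⟩, hx3, hx4⟩ := ((h1.and h2).and h3).exists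
  exact D.no_between hnc hS hi hnt hk hk1 hk2 (lt_of_le_of_lt (le_max_left _ _) hx3)
    (lt_of_le_of_lt (le_max_right _ _) hx3) hx4 hx1 hx2

/-- If the lower arc `i` reaches the charged vertex `w`, then `w` is its right endpoint.
[folklore] -/
theorem wPt_eq_r_of_eq (hnc : ∀ i ∈ A, ∀ j ∈ A, ¬ D.Crosses i j) (hS : D.SubDrawing A T)
    {i : ι} (hi : i ∈ A) (hnt : ¬ D.IsTop A i) (h : D.f i (D.wPt A T i).1 = (D.wPt A T i).2) :
    D.wPt A T i = D.r i := by
  obtain ⟨hwT, hvw, hwri, -, -, -⟩ := D.mem_Wset.1 (D.wPt_mem hnc hS hi hnt)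
  rcases hwri.lt_or_eq with hlt | heq
  · exact absurd h (D.avoid i _ (hS.subset hwT) hvw hlt)
  · refine Prod.ext heq ?_
    rw [← h, heq, D.f_r i]

/-- If the upper arc `succ i` reaches the charged vertex `w`, then `w` is its right endpoint.
[folklore] -/
theorem wPt_eq_r_succ_of_eq (hnc : ∀ i ∈ A, ∀ j ∈ A, ¬ D.Crosses i j) (hS : D.SubDrawing A T)
    {i : ι} (hi : i ∈ A) (hnt : ¬ D.IsTop A i)
    (h : D.f (D.succ A i) (D.wPt A T i).1 = (D.wPt A T i).2) :
    D.wPt A T i = D.r (D.succ A i) := by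
  obtain ⟨hj, -, -⟩ := D.succ_spec hnt
  obtain ⟨-, hlj⟩ := D.mem_out.1 hj
  obtain ⟨hwT, hvw, -, hwrj, -, -⟩ := D.mem_Wset.1 (D.wPt_mem hnc hS hi hnt)
  rcases hwrj.lt_or_eq with hlt | heq
  · exact absurd h (D.avoid (D.succ A i) _ (hS.subset hwT) (by rw [hlj]; exact hvw) hlt)
  · refine Prod.ext heq ?_
    rw [← h, heq, D.f_r]

/-- The charged vertex is not the right endpoint of both arcs of the gap (simplicity).
[folklore] -/
theorem not_wPt_eq_both {i : ι} (hnt : ¬ D.IsTop A i) (h1 : D.wPt A T i = D.r i)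
    (h2 : D.wPt A T i = D.r (D.succ A i)) : False := by
  obtain ⟨hj, hkey, -⟩ := D.succ_spec hnt
  obtain ⟨-, hlj⟩ := D.mem_out.1 hj
  have := D.simple i (D.succ A i) hlj.symm (h1.symm.trans h2)
  rw [← this] at hkey
  exact lt_irrefl _ hkey

/-- The **type** of the gap above `i` at its charged vertex `w`: `0` if `w` is the right end of
`i`, `1` if it is the right end of `succ i`, `2` if `w` lies strictly between the two arcs.
[folklore] -/
def gapType (A : Finset ι) (T : Finset (ℝ × ℝ)) (i : ι) : Fin 3 :=
  if D.wPt A T i = D.r i then 0 else if D.wPt A T i = D.r (D.succ A i) then 1 else 2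

/-- Type `0` means: the charged vertex is the right endpoint of the lower arc. [folklore] -/
theorem gapType_eq_zero_iff {i : ι} : D.gapType A T i = 0 ↔ D.wPt A T i = D.r i := by
  unfold gapType
  by_cases h : D.wPt A T i = D.r i
  · simp [h]
  · rw [if_neg h]
    constructor
    · intro h'
      split_ifs at h' with h'' <;> exact absurd h' (by decide)
    · intro h'
      exact absurd h' h

/-- Two distinct non-top arcs cannot charge the same vertex with the same type, given that the
first lies below the second just to the left of that vertex. [folklore] -/
theorem gap_aux (hnc : ∀ i ∈ A, ∀ j ∈ A, ¬ D.Crosses i j) (hS : D.SubDrawing A T)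
    {i i' : ι} (hi : i ∈ A) (hi' : i' ∈ A) (hnt : ¬ D.IsTop A i) (hnt' : ¬ D.IsTop A i')
    (hw : D.wPt A T i' = D.wPt A T i) (ht : D.gapType A T i' = D.gapType A T i)
    (hlt : ∀ᶠ x in 𝓝[<] (D.wPt A T i).1, D.f i x < D.f i' x) : False := by
  obtain ⟨hj, hkey, -⟩ := D.succ_spec hnt
  obtain ⟨hjA, hlj⟩ := D.mem_out.1 hj
  obtain ⟨hwT, hvw, hwri, hwrj, hfiw, hfjw⟩ := D.mem_Wset.1 (D.wPt_mem hnc hS hi hnt)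
  have hmem' := D.wPt_mem hnc hS hi' hnt'
  rw [hw] at hmem'
  obtain ⟨-, hvw', hwri', -, hfiw', -⟩ := D.mem_Wset.1 hmem'
  -- in every type, `f i' (w.1) < f (succ i) (w.1)`
  have hval : D.f i' (D.wPt A T i).1 < D.f (D.succ A i) (D.wPt A T i).1 := by
    by_cases h0 : D.wPt A T i = D.r i'
    · -- type 0 for `i'`, hence for `i`: `w = r i`, and then `w.2 < f (succ i) w.1`
      have ht' : D.gapType A T i' = 0 := D.gapType_eq_zero_iff.2 (hw.trans h0)
      have hti : D.wPt A T i = D.r i := D.gapType_eq_zero_iff.1 (ht ▸ ht')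
      have hfi' : D.f i' (D.wPt A T i).1 = (D.wPt A T i).2 := by rw [h0, D.f_r i']
      rw [hfi']
      rcases hfjw.lt_or_eq with hlt' | heq'
      · exact hlt'
      · exact (D.not_wPt_eq_both hnt hti (D.wPt_eq_r_succ_of_eq hnc hS hi hnt heq'.symm)).elim
    · have hne' : D.f i' (D.wPt A T i).1 ≠ (D.wPt A T i).2 := by
        intro h
        apply h0
        have := D.wPt_eq_r_of_eq hnc hS hi' hnt' (by rw [hw]; exact h)
        rwa [hw] at this
      exact lt_of_lt_of_le (lt_of_le_of_ne hfiw' hne') hfjw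
  have h1 : Tendsto (D.f i') (𝓝[<] (D.wPt A T i).1) (𝓝 (D.f i' (D.wPt A T i).1)) :=
    D.tendsto_nhdsLT hvw' hwri'
  have h2 : Tendsto (D.f (D.succ A i)) (𝓝[<] (D.wPt A T i).1)
      (𝓝 (D.f (D.succ A i) (D.wPt A T i).1)) :=
    D.tendsto_nhdsLT (by rw [hlj]; exact hvw) hwrj
  exact D.no_between_eventually hnc hS hi hnt hi' hvw' hwri' hlt (h1.eventually_lt h2 hval)

/-- **Injectivity of the charging.** Distinct non-top arcs charge distinct (vertex, type) pairs.
[folklore] -/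
theorem eq_of_wPt_eq_of_gapType_eq (hnc : ∀ i ∈ A, ∀ j ∈ A, ¬ D.Crosses i j)
    (hS : D.SubDrawing A T) {i i' : ι} (hi : i ∈ A) (hi' : i' ∈ A) (hnt : ¬ D.IsTop A i)
    (hnt' : ¬ D.IsTop A i') (hw : D.wPt A T i = D.wPt A T i')
    (ht : D.gapType A T i = D.gapType A T i') : i = i' := by
  by_contra hne
  obtain ⟨-, hvw, hwri, -, -, -⟩ := D.mem_Wset.1 (D.wPt_mem hnc hS hi hnt)
  have hmem' := D.wPt_mem hnc hS hi' hnt'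
  rw [← hw] at hmem'
  obtain ⟨-, hvw', hwri', -, -, -⟩ := D.mem_Wset.1 hmem'
  set w := D.wPt A T i with hwdef
  have hm : max (D.l i).1 (D.l i').1 < w.1 := max_lt hvw hvw'
  set x₁ := (max (D.l i).1 (D.l i').1 + w.1) / 2 with hx₁def
  have hx₁l : max (D.l i).1 (D.l i').1 < x₁ := by rw [hx₁def]; linarith
  have hx₁r : x₁ < w.1 := by rw [hx₁def]; linarith
  have hxi : (D.l i).1 < x₁ ∧ x₁ < (D.r i).1 :=
    ⟨lt_of_le_of_lt (le_max_left _ _) hx₁l, hx₁r.trans_le hwri⟩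
  have hxi' : (D.l i').1 < x₁ ∧ x₁ < (D.r i').1 :=
    ⟨lt_of_le_of_lt (le_max_right _ _) hx₁l, hx₁r.trans_le hwri'⟩
  have hneval : D.f i x₁ ≠ D.f i' x₁ := fun h =>
    hnc i hi i' hi' ⟨hne, x₁, hxi.1, hxi.2, hxi'.1, hxi'.2, h⟩
  rcases lt_or_gt_of_ne hneval with hlt | hgt
  · have hev : ∀ᶠ x in 𝓝[<] w.1, D.f i x < D.f i' x := by
      filter_upwards [Ioo_mem_nhdsLT hm] with x hx
      exact D.lt_of_lt_of_not_crosses hne (hnc i hi i' hi') hxi hxi'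
        ⟨lt_of_le_of_lt (le_max_left _ _) hx.1, hx.2.trans_le hwri⟩
        ⟨lt_of_le_of_lt (le_max_right _ _) hx.1, hx.2.trans_le hwri'⟩ hlt
    exact D.gap_aux hnc hS hi hi' hnt hnt' hw.symm ht.symm hev
  · have hev : ∀ᶠ x in 𝓝[<] (D.wPt A T i').1, D.f i' x < D.f i x := by
      rw [← hw]
      filter_upwards [Ioo_mem_nhdsLT hm] with x hx
      exact D.lt_of_lt_of_not_crosses (Ne.symm hne) (hnc i' hi' i hi) hxi' hxi
        ⟨lt_of_le_of_lt (le_max_right _ _) hx.1, hx.2.trans_le hwri'⟩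
        ⟨lt_of_le_of_lt (le_max_left _ _) hx.1, hx.2.trans_le hwri⟩ hgt
    exact D.gap_aux hnc hS hi' hi hnt' hnt hw ht hev

/-- **The planar case of the crossing lemma for `x`-monotone arcs.** If no two arcs of the
sub-drawing `A` on the vertex set `T` cross, then `#A ≤ 4 · #T`: top arcs of fans inject into `T`
by their left endpoint, non-top arcs inject into `T × Fin 3` by (charged vertex, type).
[folklore] -/
theorem card_le_four_mul_card (hnc : ∀ i ∈ A, ∀ j ∈ A, ¬ D.Crosses i j)
    (hS : D.SubDrawing A T) : A.card ≤ 4 * T.card := by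
  classical
  set Top := A.filter fun i => D.IsTop A i with hTop
  set Non := A.filter fun i => ¬ D.IsTop A i with hNon
  have hsplit : Top.card + Non.card = A.card := Finset.card_filter_add_card_filter_not _
  have hTopc : Top.card ≤ T.card := by
    refine Finset.card_le_card_of_injOn D.l (fun i hi => hS.l_mem i (Finset.mem_filter.1 hi).1) ?_
    intro i hi i' hi' hll
    obtain ⟨hiA, hti⟩ := Finset.mem_filter.1 hi
    obtain ⟨hi'A, hti'⟩ := Finset.mem_filter.1 hi'
    have hiout : i ∈ D.out A (D.l i) := D.mem_out.2 ⟨hiA, rfl⟩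
    have hi'out : i' ∈ D.out A (D.l i) := D.mem_out.2 ⟨hi'A, hll.symm⟩
    have h1 : D.key A (D.l i) i' ≤ D.key A (D.l i) i := hti i' hi'out
    have h2 : D.key A (D.l i) i ≤ D.key A (D.l i) i' := by
      have := hti' i (by rw [← hll]; exact hiout)
      rwa [← hll] at this
    exact D.eq_of_key_eq hnc hiout hi'out (le_antisymm h2 h1)
  have hNonc : Non.card ≤ 3 * T.card := by
    have h : Non.card ≤ (T ×ˢ (Finset.univ : Finset (Fin 3))).card := by
      refine Finset.card_le_card_of_injOn (fun i => (D.wPt A T i, D.gapType A T i)) ?_ ?_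
      · intro i hi
        obtain ⟨hiA, hnt⟩ := Finset.mem_filter.1 hi
        exact Finset.mem_product.2
          ⟨(D.mem_Wset.1 (D.wPt_mem hnc hS hiA hnt)).1, Finset.mem_univ _⟩
      · intro i hi i' hi' h
        obtain ⟨hiA, hnt⟩ := Finset.mem_filter.1 hi
        obtain ⟨hi'A, hnt'⟩ := Finset.mem_filter.1 hi'
        exact D.eq_of_wPt_eq_of_gapType_eq hnc hS hiA hi'A hnt hnt' (Prod.ext_iff.1 h).1
          (Prod.ext_iff.1 h).2
    rw [Finset.card_product, Finset.card_univ, Fintype.card_fin] at h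
    omega
  omega

end gap

/-! ### Removing crossings one at a time -/

open Classical in
/-- The ordered pairs of crossing arcs inside `A`. [folklore] -/
def crossPairs (A : Finset ι) : Finset (ι × ι) := (A ×ˢ A).filter fun p => D.Crosses p.1 p.2

open Classical in
/-- Membership in `crossPairs`. [folklore] -/
theorem mem_crossPairs {A : Finset ι} {p : ι × ι} :
    p ∈ D.crossPairs A ↔ (p.1 ∈ A ∧ p.2 ∈ A) ∧ D.Crosses p.1 p.2 := by
  unfold crossPairs
  rw [Finset.mem_filter, Finset.mem_product]

/-- **Crossings versus edges.** For every sub-drawing, `2·#A ≤ 8·#T + #crossPairs A`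
(delete one arc of some crossing pair and induct; the planar case is `card_le_four_mul_card`).
[folklore] -/
theorem two_mul_card_le {T : Finset (ℝ × ℝ)} (A : Finset ι)
    (hS : D.SubDrawing A T) : 2 * A.card ≤ 8 * T.card + (D.crossPairs A).card := by
  classical
  induction A using Finset.strongInduction with
  | H A ih =>
    by_cases h : ∃ i ∈ A, ∃ j ∈ A, D.Crosses i j
    · obtain ⟨i, hi, j, hj, hc⟩ := h
      have hS' : D.SubDrawing (A.erase i) T :=
        ⟨hS.subset, fun k hk => hS.l_mem k (Finset.mem_of_mem_erase hk),
          fun k hk => hS.r_mem k (Finset.mem_of_mem_erase hk)⟩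
      have hih := ih (A.erase i) (Finset.erase_ssubset hi) hS'
      have hij : i ≠ j := hc.1
      have hmem1 : (i, j) ∈ D.crossPairs A := D.mem_crossPairs.2 ⟨⟨hi, hj⟩, hc⟩
      have hmem2 : (j, i) ∈ (D.crossPairs A).erase (i, j) :=
        Finset.mem_erase.2 ⟨fun h => hij (Prod.ext_iff.1 h).2,
          D.mem_crossPairs.2 ⟨⟨hj, hi⟩, hc.symm⟩⟩
      have hsub : D.crossPairs (A.erase i) ⊆ ((D.crossPairs A).erase (i, j)).erase (j, i) := by
        intro p hp
        obtain ⟨⟨hp1, hp2⟩, hpc⟩ := D.mem_crossPairs.1 hp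
        have hp1' := Finset.mem_erase.1 hp1
        have hp2' := Finset.mem_erase.1 hp2
        refine Finset.mem_erase.2 ⟨?_, Finset.mem_erase.2 ⟨?_,
          D.mem_crossPairs.2 ⟨⟨hp1'.2, hp2'.2⟩, hpc⟩⟩⟩
        · intro h
          rw [h] at hp2'
          exact hp2'.1 rfl
        · intro h
          rw [h] at hp1'
          exact hp1'.1 rfl
      have hc1 := Finset.card_le_card hsub
      have hc2 := Finset.card_erase_of_mem hmem2
      have hc3 := Finset.card_erase_of_mem hmem1
      have hc4 : 1 ≤ ((D.crossPairs A).erase (i, j)).card := Finset.card_pos.2 ⟨_, hmem2⟩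
      have hcardA : (A.erase i).card + 1 = A.card := Finset.card_erase_add_one hi
      omega
    · have h' : ∀ i ∈ A, ∀ j ∈ A, ¬ D.Crosses i j := fun i hi j hj hc => h ⟨i, hi, j, hj, hc⟩
      have := D.card_le_four_mul_card h' hS
      omega

/-! ### Bernoulli weights on vertex subsets -/

/-- The Bernoulli(`p`) weight of a vertex subset `T ⊆ V`. [folklore] -/
def wt (p : ℝ) (T : Finset (ℝ × ℝ)) : ℝ := p ^ T.card * (1 - p) ^ (D.V.card - T.card)

/-- The weights of the supersets of `B ⊆ V` sum to `p ^ #B` (a product-measure identity).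
[folklore] -/
theorem sum_wt_superset (p : ℝ) {B : Finset (ℝ × ℝ)} (hB : B ⊆ D.V) :
    ∑ T ∈ D.V.powerset, (if B ⊆ T then D.wt p T else 0) = p ^ B.card := by
  rw [← Finset.sum_filter]
  have himage : D.V.powerset.filter (fun T => B ⊆ T) =
      (D.V \ B).powerset.image fun T' => B ∪ T' := by
    ext T
    simp only [Finset.mem_filter, Finset.mem_powerset, Finset.mem_image]
    constructor
    · rintro ⟨hTV, hBT⟩
      refine ⟨T \ B, fun x hx => ?_, Finset.union_sdiff_of_subset hBT⟩
      rw [Finset.mem_sdiff] at hx ⊢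
      exact ⟨hTV hx.1, hx.2⟩
    · rintro ⟨T', hT', rfl⟩
      refine ⟨Finset.union_subset hB fun x hx => (Finset.mem_sdiff.1 (hT' hx)).1,
        Finset.subset_union_left⟩
  have hdisj : ∀ T' ∈ (D.V \ B).powerset, Disjoint B T' := fun T' hT' =>
    Finset.disjoint_left.2 fun x hxB hxT' =>
      (Finset.mem_sdiff.1 (Finset.mem_powerset.1 hT' hxT')).2 hxB
  rw [himage, Finset.sum_image]
  · have hVB : (D.V \ B).card = D.V.card - B.card := Finset.card_sdiff_of_subset hB
    have hBle : B.card ≤ D.V.card := Finset.card_le_card hB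
    have hterm : ∀ T' ∈ (D.V \ B).powerset, D.wt p (B ∪ T') =
        p ^ B.card * (p ^ T'.card * (1 - p) ^ ((D.V \ B).card - T'.card)) := by
      intro T' hT'
      unfold wt
      rw [Finset.card_union_of_disjoint (hdisj T' hT'), hVB, pow_add]
      have : D.V.card - (B.card + T'.card) = D.V.card - B.card - T'.card := by omega
      rw [this]
      ring
    rw [Finset.sum_congr rfl hterm, ← Finset.mul_sum, Finset.sum_pow_mul_eq_add_pow]
    have : p + (1 - p) = 1 := by ring
    rw [this, one_pow, mul_one]
  · intro T₁ hT₁ T₂ hT₂ heq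
    have h1 := hdisj T₁ hT₁
    have h2 := hdisj T₂ hT₂
    have heq' : B ∪ T₁ = B ∪ T₂ := heq
    rw [← Finset.union_sdiff_cancel_left h1, heq', Finset.union_sdiff_cancel_left h2]

/-- `E[#T] = p · #V`. [folklore] -/
theorem sum_wt_mul_card (p : ℝ) :
    ∑ T ∈ D.V.powerset, D.wt p T * T.card = p * D.V.card := by
  have hT : ∀ T ∈ D.V.powerset, D.wt p T * (T.card : ℝ) =
      ∑ v ∈ D.V, (if ({v} : Finset (ℝ × ℝ)) ⊆ T then D.wt p T else 0) := by
    intro T hT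
    have hTV := Finset.mem_powerset.1 hT
    rw [← Finset.sum_filter]
    have : D.V.filter (fun v => ({v} : Finset (ℝ × ℝ)) ⊆ T) = T := by
      ext v
      simp only [Finset.mem_filter, Finset.singleton_subset_iff]
      exact ⟨fun h => h.2, fun h => ⟨hTV h, h⟩⟩
    rw [this, Finset.sum_const, nsmul_eq_mul, mul_comm]
  rw [Finset.sum_congr rfl hT, Finset.sum_comm]
  rw [Finset.sum_congr rfl fun v hv =>
    D.sum_wt_superset p (Finset.singleton_subset_iff.2 hv)]
  simp [mul_comm]

/-- Four pairwise distinct points form a set of cardinality `4`. [folklore] -/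
theorem card_four {a b c d : ℝ × ℝ} (hab : a ≠ b) (hac : a ≠ c) (had : a ≠ d) (hbc : b ≠ c)
    (hbd : b ≠ d) (hcd : c ≠ d) : ({a, b, c, d} : Finset (ℝ × ℝ)).card = 4 := by
  rw [Finset.card_insert_of_notMem (by simp [hab, hac, had]),
    Finset.card_insert_of_notMem (by simp [hbc, hbd]), Finset.card_pair hcd]

/-! ### The crossing lemma (probabilistic amplification as a weighted sum) -/

section sampling

variable [Fintype ι]

/-- The arcs with both endpoints in `T` (the sub-drawing induced on `T`). [folklore] -/
def induced (T : Finset (ℝ × ℝ)) : Finset ι :=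
  Finset.univ.filter fun i => D.l i ∈ T ∧ D.r i ∈ T

/-- Membership in the induced sub-drawing. [folklore] -/
theorem mem_induced {T : Finset (ℝ × ℝ)} {i : ι} : i ∈ D.induced T ↔ D.l i ∈ T ∧ D.r i ∈ T := by
  simp [induced]

/-- The induced arcs form a sub-drawing on `T`. [folklore] -/
theorem subDrawing_induced {T : Finset (ℝ × ℝ)} (hT : T ⊆ D.V) : D.SubDrawing (D.induced T) T :=
  ⟨hT, fun _ hi => (D.mem_induced.1 hi).1, fun _ hi => (D.mem_induced.1 hi).2⟩

/-- `E[#arcs induced on T] = p² · e`. [folklore] -/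
theorem sum_wt_mul_card_induced (p : ℝ) :
    ∑ T ∈ D.V.powerset, D.wt p T * (D.induced T).card = p ^ 2 * Fintype.card ι := by
  have hT : ∀ T ∈ D.V.powerset, D.wt p T * ((D.induced T).card : ℝ) =
      ∑ i : ι, (if ({D.l i, D.r i} : Finset (ℝ × ℝ)) ⊆ T then D.wt p T else 0) := by
    intro T _
    rw [← Finset.sum_filter]
    have : (Finset.univ.filter fun i : ι => ({D.l i, D.r i} : Finset (ℝ × ℝ)) ⊆ T) =
        D.induced T := by
      ext i
      simp [induced, Finset.insert_subset_iff]
    rw [this, Finset.sum_const, nsmul_eq_mul, mul_comm]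
  have hpair : ∀ i : ι, ({D.l i, D.r i} : Finset (ℝ × ℝ)).card = 2 := fun i => by
    rw [Finset.card_pair]
    intro h
    have := D.fst_lt i
    rw [h] at this
    exact lt_irrefl _ this
  rw [Finset.sum_congr rfl hT, Finset.sum_comm]
  rw [Finset.sum_congr rfl fun i _ => by
    rw [D.sum_wt_superset p (Finset.insert_subset_iff.2
      ⟨D.l_mem i, Finset.singleton_subset_iff.2 (D.r_mem i)⟩), hpair i]]
  simp [mul_comm]

/-- `E[#crossing pairs induced on T] = p⁴ · X` when crossing arcs have four distinct endpoints.
[folklore] -/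
theorem sum_wt_mul_card_crossPairs (p : ℝ)
    (h4 : ∀ i j, D.Crosses i j → D.l i ≠ D.l j ∧ D.l i ≠ D.r j ∧ D.r i ≠ D.l j ∧ D.r i ≠ D.r j) :
    ∑ T ∈ D.V.powerset, D.wt p T * (D.crossPairs (D.induced T)).card =
      p ^ 4 * (D.crossPairs Finset.univ).card := by
  have hT : ∀ T ∈ D.V.powerset, D.wt p T * ((D.crossPairs (D.induced T)).card : ℝ) =
      ∑ q ∈ D.crossPairs Finset.univ,
        (if ({D.l q.1, D.r q.1, D.l q.2, D.r q.2} : Finset (ℝ × ℝ)) ⊆ T then D.wt p T else 0) := by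
    intro T _
    rw [← Finset.sum_filter]
    have : (D.crossPairs Finset.univ).filter
        (fun q : ι × ι => ({D.l q.1, D.r q.1, D.l q.2, D.r q.2} : Finset (ℝ × ℝ)) ⊆ T) =
        D.crossPairs (D.induced T) := by
      ext q
      simp only [Finset.mem_filter, mem_crossPairs, mem_induced, Finset.insert_subset_iff,
        Finset.singleton_subset_iff, Finset.mem_univ, true_and]
      tauto
    rw [this, Finset.sum_const, nsmul_eq_mul, mul_comm]
  have hfour : ∀ q ∈ D.crossPairs Finset.univ,
      ({D.l q.1, D.r q.1, D.l q.2, D.r q.2} : Finset (ℝ × ℝ)).card = 4 := by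
    intro q hq
    obtain ⟨h1, h2, h3, h4'⟩ := h4 q.1 q.2 (D.mem_crossPairs.1 hq).2
    refine card_four (fun h => ?_) h1 h2 h3 h4' (fun h => ?_)
    · have := D.fst_lt q.1
      rw [h] at this
      exact lt_irrefl _ this
    · have := D.fst_lt q.2
      rw [h] at this
      exact lt_irrefl _ this
  rw [Finset.sum_congr rfl hT, Finset.sum_comm]
  rw [Finset.sum_congr rfl fun q hq => by
    rw [D.sum_wt_superset p (Finset.insert_subset_iff.2 ⟨D.l_mem _, Finset.insert_subset_iff.2
      ⟨D.r_mem _, Finset.insert_subset_iff.2 ⟨D.l_mem _, Finset.singleton_subset_iff.2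
      (D.r_mem _)⟩⟩⟩), hfour q hq]]
  simp [mul_comm]

/-- **The crossing lemma for `x`-monotone arc systems.** If crossing arcs never share an
endpoint and the number of arcs `e` is at least `8 · #V`, then `e³ ≤ 64 · #V² · X`, where `X`
is the number of ordered crossing pairs (Ajtai–Chvátal–Newborn–Szemerédi 1982, Leighton 1983;
here for function-graph drawings, with the planar bound `4·#V` in place of Euler's `3·#V - 6`,
proved by the weighted average of `two_mul_card_le` over Bernoulli(`8#V/e`) vertex samples).
[cite: AjtaiEtAl1982, crossing lemma; variant for x-monotone arc systems] -/
theorem crossing_inequality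
    (h4 : ∀ i j, D.Crosses i j → D.l i ≠ D.l j ∧ D.l i ≠ D.r j ∧ D.r i ≠ D.l j ∧ D.r i ≠ D.r j)
    (he : 8 * D.V.card ≤ Fintype.card ι) :
    (Fintype.card ι : ℝ) ^ 3 ≤ 64 * (D.V.card : ℝ) ^ 2 * (D.crossPairs Finset.univ).card := by
  rcases Nat.eq_zero_or_pos (Fintype.card ι) with he0 | hepos
  · rw [he0]
    have h0 : ((0 : ℕ) : ℝ) ^ 3 = 0 := by norm_num
    rw [h0]
    positivity
  have hNpos : 0 < D.V.card := by
    obtain ⟨i⟩ := Fintype.card_pos_iff.1 hepos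
    exact Finset.card_pos.2 ⟨D.l i, D.l_mem i⟩
  set N : ℕ := D.V.card with hNdef
  set e : ℕ := Fintype.card ι with hedef
  set X : ℕ := (D.crossPairs Finset.univ).card with hXdef
  have hepos' : (0 : ℝ) < e := by exact_mod_cast hepos
  have hNpos' : (0 : ℝ) < N := by exact_mod_cast hNpos
  set p : ℝ := 8 * N / e with hpdef
  have hp0 : 0 < p := by positivity
  have hp1 : p ≤ 1 := by
    rw [hpdef, div_le_one hepos']
    exact_mod_cast he
  have hpe : p * e = 8 * N := by
    rw [hpdef]
    field_simp
  have hineq : ∀ T ∈ D.V.powerset, D.wt p T * (2 * ((D.induced T).card : ℝ)) ≤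
      D.wt p T * (8 * (T.card : ℝ) + (D.crossPairs (D.induced T)).card) := by
    intro T hT
    have hw : 0 ≤ D.wt p T := by
      unfold wt
      exact mul_nonneg (pow_nonneg hp0.le _) (pow_nonneg (by linarith) _)
    refine mul_le_mul_of_nonneg_left ?_ hw
    exact_mod_cast D.two_mul_card_le (D.induced T) (D.subDrawing_induced (Finset.mem_powerset.1 hT))
  have hsum := Finset.sum_le_sum hineq
  have lhs : ∑ T ∈ D.V.powerset, D.wt p T * (2 * ((D.induced T).card : ℝ)) = 2 * (p ^ 2 * e) := by
    rw [← D.sum_wt_mul_card_induced p, Finset.mul_sum]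
    exact Finset.sum_congr rfl fun T _ => by ring
  have rhs : ∑ T ∈ D.V.powerset, D.wt p T * (8 * (T.card : ℝ) + (D.crossPairs (D.induced T)).card)
      = 8 * (p * N) + p ^ 4 * X := by
    rw [← D.sum_wt_mul_card p, ← D.sum_wt_mul_card_crossPairs p h4, Finset.mul_sum,
      ← Finset.sum_add_distrib]
    exact Finset.sum_congr rfl fun T _ => by ring
  rw [lhs, rhs] at hsum
  have h8 : 8 * (p * N) = p ^ 2 * e := by
    calc 8 * (p * N) = p * (8 * N) := by ring
      _ = p * (p * e) := by rw [hpe]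
      _ = p ^ 2 * e := by ring
  rw [h8] at hsum
  -- `p² e ≤ p⁴ X`, i.e. `e ≤ p² X = 64 N² X / e²`
  have hmain : (e : ℝ) ≤ p ^ 2 * X := by
    have h' : p ^ 2 * e ≤ p ^ 2 * (p ^ 2 * X) := by nlinarith
    exact le_of_mul_le_mul_left h' (by positivity)
  have hp2 : p ^ 2 = 64 * N ^ 2 / e ^ 2 := by
    rw [hpdef]
    field_simp
    ring
  rw [hp2, div_mul_eq_mul_div, le_div_iff₀ (by positivity)] at hmain
  have h3 : (e : ℝ) ^ 3 = (e : ℝ) * (e : ℝ) ^ 2 := by ring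
  rw [h3]
  exact hmain

end sampling

end ArcSystem

end Literature.Combinatorics.Extremal
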